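import Literature.Probability.RandomPlanarGeometry.ChordalRestrictionMarkov

/-!
# The renewal identity hidden in the typed domain Markov property

By-product of the cdisprove unit on crux `CardyRotToConfR2SymmetryUpgrade`
(stmt-CriticalPhenomena-0698). The typed Markov axiom `ChordalFamily.IsMarkovExtension P Q` has a
`domain` clause ("`Q D past` depends only on the remaining set, the tip and the target") and an
`initial` clause (`Q D (const a) = P D`). Together they force a **renewal identity**: whenever the
remaining domain of an explored configuration `(D, past)` happens to be the carrier of a Dobrushin
(Jordan) domain `D₂` whose marked points are the tip and the target, the conditional law of the
future IS the family's own fresh law `P D₂` (`kernel_eq_of_jordan_remaining`). This is the mechanism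
that kills every "hidden-label mixture" candidate (prior ≠ posterior at the first boundary landing,
REVIEW.md of the crux item) and that any SLE₆-decoration candidate (germ-label transport) must
satisfy at boundary landings; combined with `TargetIndependence.lean` (admissible curves do touch
the boundary) it shows the typed Markov property is NOT vacuous on admissible families, although it
is nearly vacuous on boundary-avoiding simple curves (design note of `ChordalRestrictionMarkov`).
Also recorded: the kernel at the trivial past of ANY domain with the same carrier and marks is the
fresh law (`kernel_const_eq`), and two Markov extensions of the same family agree at every
configuration whose remaining domain is Jordan (`kernel_unique_of_jordan_remaining`).
-/

noncomputable section

open Set MeasureTheory Topology Filter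

namespace Summit.CriticalPhenomena.CardyFormulaZ2.Theorems.CardyRotToConfR2SymmetryUpgrade.Negative

open Literature.Probability.RandomPlanarGeometry
open Literature.Probability.RandomPlanarGeometry.ChordalFamily

variable {P : ChordalFamily} {Q : DobrushinDomain → CurveClass ℂ → Measure (CurveClass ℂ)}

/-- **Renewal at Jordan remaining domains.** If the remaining domain of `(D, past)` is the carrier
of a Dobrushin domain `D₂` with `D₂.pt 0 = past.target` and `D₂.pt 1 = D.pt 1`, then the Markov
kernel there is the fresh law: `Q D past = P D₂` (`domain` + `initial` +
`remainingDomain_mk_const`). [cite: Werner2007, §3.2] -/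
theorem kernel_eq_of_jordan_remaining (hQ : P.IsMarkovExtension Q) {D D₂ : DobrushinDomain}
    {past : CurveClass ℂ} (h : remainingDomain D past = D₂.carrier)
    (ht : past.target = D₂.pt 0) (hb : D.pt 1 = D₂.pt 1) : Q D past = P D₂ := by
  rw [← hQ.initial D₂]
  refine hQ.domain D D₂ past _ ?_ (by simpa [Curve.target_def] using ht) hb
  rw [h, remainingDomain_mk_const]

/-- The kernel at the trivial past of any Dobrushin domain with the same carrier and marked points
is the fresh law of that domain (so a Markov family cannot read the boundary parametrisation).
[folklore] -/
theorem kernel_const_eq (hQ : P.IsMarkovExtension Q) {D D₂ : DobrushinDomain}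
    (hc : D.carrier = D₂.carrier) (h0 : D.pt 0 = D₂.pt 0) (h1 : D.pt 1 = D₂.pt 1) :
    Q D (CurveClass.mk (Curve.const (D.pt 0))) = P D₂ :=
  kernel_eq_of_jordan_remaining hQ (by rw [remainingDomain_mk_const, hc])
    (by simp [Curve.target_def, h0]) h1

/-- Two Markov extensions of the same family agree at every configuration whose remaining domain
is a Jordan carrier with the right marks. [folklore] -/
theorem kernel_unique_of_jordan_remaining
    {Q' : DobrushinDomain → CurveClass ℂ → Measure (CurveClass ℂ)}
    (hQ : P.IsMarkovExtension Q) (hQ' : P.IsMarkovExtension Q') {D D₂ : DobrushinDomain}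
    {past : CurveClass ℂ} (h : remainingDomain D past = D₂.carrier)
    (ht : past.target = D₂.pt 0) (hb : D.pt 1 = D₂.pt 1) : Q D past = Q' D past := by
  rw [kernel_eq_of_jordan_remaining hQ h ht hb, kernel_eq_of_jordan_remaining hQ' h ht hb]

end Summit.CriticalPhenomena.CardyFormulaZ2.Theorems.CardyRotToConfR2SymmetryUpgrade.Negative
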